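import Summits.Langlands.Langlands.Theses.ParityBlindBianchi

/-!
# Route ParityBlindBianchi — Assembly (item stmt-Langlands-15109, rev 8)

The documentary assembly item of route `ParityBlindBianchi` for the Langlands summit:

`ResidualBianchiDoorLevel → TwoAdicBianchiProModularityLevel → ArtinWeightRealisationLevel →
IcosahedralDescentLevel → EvenArtinJunction → Langlands`.

Since rev 8 of the route (2026-08-16, crux-only deciding theorem with level control) the route
file's certified deciding theorem
`Summit.Langlands.Langlands.Theses.ParityBlindBianchi.closes` has exactly this type: its five
hypotheses are the five cruxes E1′ `ResidualBianchiDoorLevel`, E2′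
`TwoAdicBianchiProModularityLevel`, R′ `ArtinWeightRealisationLevel`, D′ `IcosahedralDescentLevel`
and the junction `EvenArtinJunction`, and its conclusion is the summit statement `Langlands`.
The item therefore carries no mathematics of its own: after unfolding `Assembly` the goal is closed
by `closes` (whose proof — an abstract field isomorphism `ℚ̄₂ ≃+* ℂ` by Steinitz, then pure
instantiation of the chain — lives in the route file and is kernel-checked there).

Filed as `ParityBlindBianchiAssemblyRev8.lean` because the conventional target
`ParityBlindBianchiAssembly.lean` holds the rev-7 assembly (item stmt-Langlands-13462, chain
`ResidualBianchiDoorMod2 → TwoAdicBianchiProModularity → ArtinWeightRealisation →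
IcosahedralQuadraticDescent → EvenArtinJunction → Langlands`, retired at rev 8 together with the
declarations it quantified over) and Theorems files are append-only; the theorem is named
`Assembly_rev8_proof` so that its fully-qualified name does not collide with the rev-7
`Assembly_proof` of that file.
-/

set_option linter.dupNamespace false -- project-wide option (lakefile weak.linter.dupNamespace); `Summit.Langlands.Langlands` is the mandated namespace

namespace Summit.Langlands.Langlands.Theorems.ParityBlindBianchi

/-- **Assembly of route ParityBlindBianchi** (item stmt-Langlands-15109, rev 8):
`ResidualBianchiDoorLevel → TwoAdicBianchiProModularityLevel → ArtinWeightRealisationLevel →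
IcosahedralDescentLevel → EvenArtinJunction → Langlands`. Documentary: this is verbatim the type of
the route's deciding theorem `Summit.Langlands.Langlands.Theses.ParityBlindBianchi.closes`, which
proves it (uniform bad set `S₀ ∋ 2` from E1′, 2-adic Hecke point of tame level `S₀` from E2′,
cuspidal `π_K` compatible at every place off `S₀` from R′ at `p = 2`, uniform descent `ℚ ← K` from
D′, junction to the summit). -/
theorem Assembly_rev8_proof : Summit.Langlands.Langlands.Theses.ParityBlindBianchi.Assembly := by
  unfold Summit.Langlands.Langlands.Theses.ParityBlindBianchi.Assembly
  exact Summit.Langlands.Langlands.Theses.ParityBlindBianchi.closes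

end Summit.Langlands.Langlands.Theorems.ParityBlindBianchi
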